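import Mathlib.Dynamics.Ergodic.MeasurePreserving
import Mathlib.MeasureTheory.Measure.OpenPos
import Mathlib.MeasureTheory.Measure.Lebesgue.Basic
import Mathlib.Topology.Algebra.InfiniteSum.ENNReal
import HarnessLib

/-!
# Barrier: a measure-preserving system cannot ROBUSTLY simulate the unary counter (Cotler–Rezchikov 2024, Thm. 4.20)

Barrier catalogue entry for `NavierStokesRegularity` (D-0021), machine paradigm (T. Tao's
programme: blow-up by a self-replicating "fluid computer", J. Amer. Math. Soc. 29 (2016), §1.3).
J. Cotler and S. Rezchikov, *Computational Dynamical Systems*, FOCS 2024, 166–202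
(arXiv:2409.12179, held as `paper:arxiv-2409.12179`; chunk/line locators of that text) define
what it means for a smooth finite-dimensional system `f : M → M`, `M ⊂ ℝ^k`, to simulate a
discrete machine `T : S → S` through an encoder `𝓔 : S → M` and a partial decoder `𝓓 : M ⇀ S`
of controlled complexity (Def. 1.1, p0004: `𝓓 ∘ 𝓔 = Id` and `𝓓 ∘ f^τ ∘ 𝓓⁻¹(s) = T(s)`, with a
slowdown `τ : M → ℤ_{≥0}` "constant on connected components of `𝓓⁻¹(s)`"; equivalently, Remark 1.2,
"`f^τ` takes all of `𝓓⁻¹(s)` into `𝓓⁻¹(T s)`"), and call the simulation **robust** when "for every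
`s ∈ S` … `𝓓⁻¹(s)` is the closure of its interior, and `𝓔(s)` lies in the interior of `𝓓⁻¹(s)`"
(Def. 1.3, p0005) — "some amount of `C⁰`-bounded noise `η` can be allowed in the encoding".
Their motivation names the programme this catalogue serves (p0003 L10): the universality line
"was in part motivated by the hope of showing the existence of blow-up solutions to the
Navier-Stokes equations by finding fluid flows which 'replicate themselves' at smaller and smaller
scales [tao2016finite]".

## What is printed

* **Theorem 4.20** (p0029 L1, verbatim): "Let `μ` be a Borel measure on a compact set `M ⊂ ℝⁿ`
  which assigns nonzero measure to all nonempty open sets and such that `supp(μ) = M` and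
  `μ(M) < ∞`. If `f : M → M` is a measure-preserving map with respect to `μ`, then `f` cannot be
  extended to a robust CDS for the machine `Plus : {1}* → {1}*` defined by `Plus([n]₁) = [n+1]₁`,
  where `[n]₁` denotes `n` in unary."  Printed proof (p0029 L3–L5, complete): "By contradiction,
  let `s₀ = 1` be the initial configuration of `Plus`, which visits infinitely many distinct
  configurations `{s_n}` with `s_n := Plusⁿ(s₀) = [n+1]₁`. Define `C̃_{s_n} := (f^τ)ⁿ(C_{s_0})`, and
  notice that … the `C̃_{s_n}`'s are pairwise disjoint. Since `C_{s_0}` has non-trivial interior and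
  `μ` is supported on all of `M`, we have `μ(C_{s_0}) = μ(C̃_{s_n}) > 0`. Consequently
  `∑ μ(C̃_{s_n}) = ∞`, but `∑ μ(C̃_{s_n}) = μ(⋃ C̃_{s_n}) ≤ μ(M) < ∞` which is a contradiction."
* **Corollary 4.21** (p0029; = Theorem 1.5, p0005 L21): same hypotheses ⇒ "`f` cannot be extended
  to a robustly Turing-universal CDS" (because `Plus` is a sub-machine of every universal machine);
  **Corollary 4.22**: "Symplectomorphisms of compact symplectic manifolds cannot be extended to a
  robustly Turing-universal CDS"; **Theorem 4.24** (p0029 L32): continuous-time integrable systems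
  (`f_t^* μ = μ`, `μ = g dV`, `g > 0`, `M` a union of compact invariant submanifolds) "cannot be
  extended to a robust CDS for the machine `Plus`". Printed consequence for the fluid-computer
  literature (p0005 L27): "the examples of [Cardona–Miranda–Peralta-Salas–Presas 2021] and
  subsequent papers cannot be made into robustly Turing-universal CDSs in our sense."
* For contrast (same paper): **Theorem 1.4 / 4.4** (p0005 L16, p0023 L41) — a robustly
  Turing-universal CDS with `f` a SMOOTH map of the closed disk EXISTS; **Theorem 1.6** (p0005 L30) —
  no Axiom A diffeomorphism is robustly Turing-universal. Neither is transcribed here.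

## Formal content (this file is sorry-free and asserts nothing unproved)

The dynamical core of Theorem 4.20, over Mathlib's measure theory:
* `RobustCounter f` — the data a robust CDS for `Plus` leaves inside the dynamics once encoder,
  decoder and machine are forgotten: validity regions `C n := 𝓓⁻¹([n]₁)` (`n : ℕ`), measurable
  with non-empty interior, pairwise disjoint (a decoder is a function), and slowdowns `τ n` with
  `f^[τ n]` mapping `C n` into `C (n+1)` (Remark 1.2's form of the simulation identity);
* `RobustCounterObstruction` — the catalogue entry, a `Prop`: for every finite Borel measure
  charging every non-empty open set and every measure-preserving self-map, `RobustCounter f` is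
  empty; **proved** (`RobustCounterObstruction_holds`) through the measure-theoretic lemma
  `no_measurePreserving_chain` (pairwise-disjoint measurable sets `C n` with `μ (C 0) ≠ 0` and
  `f^[τ n] '' C n ⊆ C (n+1)` are impossible under a finite `f`-invariant measure), whose proof is the
  printed pigeonhole with images replaced by preimages (`μ (C n) ≤ μ (C (n+1))` by monotonicity of
  `μ` along `C n ⊆ (f^[τ n])⁻¹(C (n+1))` and invariance — so neither injectivity of `f` nor
  measurability of images is needed);
* `no_measurePreserving_stepChain`, `no_robustCounter_flow` — the same pigeonhole for a chain of
  possibly DIFFERENT `μ`-preserving steps `g n` (e.g. the time-`τ n` maps of a measure-preserving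
  flow), i.e. the measure-theoretic core of the continuous-time **Theorem 4.24** with finiteness of
  `μ` assumed outright;
* `IsTopologicallyMixing`, `no_robust_nonhalting_run_of_mixing`, `RobustCounter.false_of_mixing` —
  the source's **Lemma 4.35** ("Let `f` be topologically mixing. Then any robust CDS … must halt on
  all inputs"), proved along its printed proof: no invariant measure needed, so it also constrains
  dissipative truncations on a mixing invariant set;
* `halvingMap`, `halvingRegion`, `halvingCounter`, `nonempty_robustCounter_halvingMap`,
  `volume_halvingRegion`, `tsum_volume_halvingRegion`, `not_measurePreserving_halvingMap` — a toy
  witness (folklore, not from the source) that both hypotheses of the entry matter: the contraction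
  `x ↦ x/2` of `ℝ` carries a perpetual robust counter whose validity regions `((1/2)^(n+1), (1/2)^n)`
  have geometrically shrinking, summable Lebesgue measures; hence it preserves no finite measure
  charging all open sets. This is the regime of the printed existence results (Thm. 1.4 of the
  source; Bournez–Graça–Hainry 2013, Thms. 19–22), recorded for the BARRIERS sections of the
  fluid-computer idea cards (cell pub-fluidc, LITERATURE §A15.6);
* `no_chain_of_uniform_measure`, `RobustCounter.false_of_uniform_measure` (UNIFORM tolerance —
  validity regions of measure `≥ ε` — is impossible under ANY finite measure, invariant or not: the
  pigeonhole behind the 'bounded memory' reading of uniformly perturbed compact systems), and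
  `translationMap`, `translationRegion`, `translationCounter`, `volume_translationRegion`,
  `measurePreserving_translationMap`, `not_isFiniteMeasure_volume_real` (the unit translation of
  `ℝ`: measure-preserving, uniform tolerance, perpetual — finiteness of `μ` cannot be dropped).
  Folklore toys completing the dichotomy of LITERATURE §A15.6; not from the source.

## References

* J. Cotler, S. Rezchikov, *Computational Dynamical Systems*, 2024 IEEE 65th Annual Symposium on
  Foundations of Computer Science (FOCS), 166–202; arXiv:2409.12179.
  [`CotlerRezchikov2024ComputationalDynamicalSystems`]
* O. Bournez, D. S. Graça, E. Hainry, *Computation with perturbed dynamical systems*,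
  J. Comput. System Sci. 79 (2013) 714–724 (the infinitesimal-perturbation notion of robustness,
  contrasted in Cotler–Rezchikov §2, p0008; Def. 12, Thm. 16: on a compact cube robustly accepted
  languages are recursive; Thms. 19–22: robust simulation of every Turing machine on unbounded or
  open domains). [`BournezGracaHainry2013`]
* R. Cardona, E. Miranda, D. Peralta-Salas, F. Presas, *Constructing Turing complete Euler flows
  in dimension 3*, PNAS 118 (2021) e2026818118. [`CMPP2021TuringCompleteEuler`]
* T. Tao, *Finite time blowup for an averaged three-dimensional Navier–Stokes equation*,
  J. Amer. Math. Soc. 29 (2016) 601–674, §1.3. [`Tao2016AveragedNS`]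
-/

namespace Literature.Barriers.NavierStokesRegularity

open MeasureTheory Set Function
open scoped ENNReal

/-- **The dynamical content of a robust computational dynamical system for the unary counter
`Plus : [n]₁ ↦ [n+1]₁`** (Cotler–Rezchikov, Def. 1.1 with Def. 1.3 and Remark 1.2, specialised to
the machine `Plus` and stripped of encoder/decoder/complexity data). `C n` is the validity region
`𝓓⁻¹([n]₁)` of the `n`-th configuration: measurable (printed: the closure of its interior, hence
closed), with non-empty interior (printed: "`𝓔(s)` lies in the interior of `𝓓⁻¹(s)`"), the regions
are pairwise disjoint (distinct configurations of one decoder), and the simulation identity in the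
form of Remark 1.2 — "`f^τ` takes all of `𝓓⁻¹(s)` into `𝓓⁻¹(T s)`" — with ONE slowdown `τ n` per
region (printed: `τ` constant on connected components of `𝓓⁻¹(s)`; see `scope_caveats` (ii) of the
entry). [cite: CotlerRezchikov2024ComputationalDynamicalSystems, Def. 1.1, Rem. 1.2, Def. 1.3 (arXiv pp. 4–5)] -/
structure RobustCounter {M : Type*} [TopologicalSpace M] [MeasurableSpace M] (f : M → M) where
  /-- validity region of the configuration `[n]₁` (the decoder fibre `𝓓⁻¹([n]₁)`) -/
  C : ℕ → Set M
  /-- slowdown: number of iterations of `f` realising one step `[n]₁ ↦ [n+1]₁` on `C n` -/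
  τ : ℕ → ℕ
  measurableSet : ∀ n, MeasurableSet (C n)
  interior_nonempty : ∀ n, (interior (C n)).Nonempty
  disjoint : Pairwise (Disjoint on C)
  mapsTo : ∀ n, MapsTo f^[τ n] (C n) (C (n + 1))

/-- **The measure-theoretic pigeonhole behind Theorem 4.20** (its printed proof, with preimages in
place of images). Under a finite `f`-invariant measure there is no chain of pairwise-disjoint
measurable sets `C 0, C 1, …` with `μ (C 0) ≠ 0` and `f^[τ n]` mapping `C n` into `C (n+1)`:
invariance and `C n ⊆ (f^[τ n])⁻¹(C (n+1))` give `μ (C 0) ≤ μ (C n)` for all `n`, so the disjoint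
union of the `C n` would have infinite measure.
[cite: CotlerRezchikov2024ComputationalDynamicalSystems, proof of Thm. 4.20 (arXiv p. 29)] -/
theorem no_measurePreserving_chain {M : Type*} [MeasurableSpace M] {μ : Measure M}
    [IsFiniteMeasure μ] {f : M → M} (hf : MeasurePreserving f μ μ) (C : ℕ → Set M) (τ : ℕ → ℕ)
    (hmeas : ∀ n, MeasurableSet (C n)) (hdisj : Pairwise (Disjoint on C))
    (hmaps : ∀ n, MapsTo f^[τ n] (C n) (C (n + 1))) (h0 : μ (C 0) ≠ 0) : False := by
  -- Step 1 (invariance + monotonicity): the measures do not decrease along the chain.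
  have hstep : ∀ n, μ (C n) ≤ μ (C (n + 1)) := by
    intro n
    calc μ (C n) ≤ μ (f^[τ n] ⁻¹' C (n + 1)) := measure_mono fun x hx => hmaps n hx
      _ = μ (C (n + 1)) := (hf.iterate (τ n)).measure_preimage (hmeas (n + 1)).nullMeasurableSet
  have hlow : ∀ n, μ (C 0) ≤ μ (C n) := by
    intro n
    induction n with
    | zero => exact le_rfl
    | succ n ih => exact ih.trans (hstep n)
  -- Step 2 (pigeonhole): the disjoint union of the `C n` has measure `∑ μ (C n) = ∞ > μ univ`.
  have hsum : μ (⋃ n, C n) = ∑' n, μ (C n) := measure_iUnion hdisj hmeas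
  have htop : ∑' n, μ (C n) = ∞ := by
    refine top_le_iff.mp ?_
    calc (⊤ : ℝ≥0∞) = ∑' _ : ℕ, μ (C 0) := (ENNReal.tsum_const_eq_top_of_ne_zero h0).symm
      _ ≤ ∑' n, μ (C n) := ENNReal.tsum_le_tsum hlow
  have hfin : μ (⋃ n, C n) < ∞ := measure_lt_top μ _
  rw [hsum, htop] at hfin
  exact lt_irrefl _ hfin

/-- **Barrier (Cotler–Rezchikov 2024, Theorem 4.20): a measure-preserving map of a finite-measure
space whose measure charges every non-empty open set admits no robust realisation of the unary
counter `Plus : [n]₁ ↦ [n+1]₁`.** For every topological measurable space `M`, every finite measure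
`μ` on `M` that is positive on non-empty open sets (printed: "a Borel measure on a compact set
`M ⊂ ℝⁿ` which assigns nonzero measure to all nonempty open sets and such that `supp(μ) = M` and
`μ(M) < ∞`"), and every `f : M → M` with `f_* μ = μ` (printed: "a measure-preserving map with respect
to `μ`"), the type `RobustCounter f` is empty (printed: "`f` cannot be extended to a robust CDS for
the machine `Plus`"). A `Prop`-valued definition; **proved below** (`RobustCounterObstruction_holds`),
so the entry carries no literature debt. Compactness of `M`, `M ⊂ ℝⁿ` and `supp μ = M` are printed
hypotheses the proof does not use and the entry drops (it is the printed statement for every such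
`M`, and more). [cite: CotlerRezchikov2024ComputationalDynamicalSystems, Thm. 4.20 and Cor. 4.21–4.22 (arXiv p. 29), Thm. 1.5 (p. 5)]

BARRIER (structured block, D-0021):
technique_class: robust-analog-simulation conservative-finite-dimensional-dynamics fixed-tolerance-iterated-cascade — realisations of an unbounded counter (hence of any universal machine, of which `Plus` is a sub-machine [cite: CotlerRezchikov2024ComputationalDynamicalSystems, Cor. 4.21]) by a FINITE-dimensional dynamical system preserving a finite measure of full support (Liouville / Lebesgue measure for symplectomorphisms, integrable Hamiltonian flows, Galerkin truncations of the incompressible EULER equations on an energy sphere, volume-preserving particle-path maps of steady Euler/Beltrami fields on compact domains), in which every configuration is decoded on a validity region with NON-EMPTY INTERIOR (tolerance to an open set of state errors) [cite: CotlerRezchikov2024ComputationalDynamicalSystems, Def. 1.3, Thm. 4.20, Cor. 4.22, Thm. 4.24].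
blocks: (a) robust Turing universality of the steady-Euler / Beltrami particle-path computers on compact domains — "the examples of [CMPP 2021] and subsequent papers cannot be made into robustly Turing-universal CDSs in our sense" [cite: CotlerRezchikov2024ComputationalDynamicalSystems, p. 5 after Thm. 1.5] [cite: CMPP2021TuringCompleteEuler, Thm. 1]; (b) inside the machine paradigm for `NavierStokesRegularity` [cite: Tao2016AveragedNS, §1.3]: any DNS-surrogate or model claim of the form "a hand-over gadget `λ → λ/2` that tolerates a FIXED open set of input errors can be re-triggered indefinitely inside a conservative (inviscid, Liouville-measure-preserving) finite truncation" — Tao's blow-up mechanism is precisely the machine `Plus` run through all `n` (scale counter `N_n ↦ N_{n+1}`), and the theorem forces the validity regions of such a counter to have summable, hence shrinking, measures.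
because: if `f` preserves a finite measure `μ` and `f^[τ n]` maps `C n` into `C (n+1)`, then `μ(C n) ≤ μ((f^[τ n])⁻¹ C(n+1)) = μ(C (n+1))`, so `μ(C n) ≥ μ(C 0) > 0` for all `n` (`C 0` has non-empty interior and `μ` charges open sets), while pairwise disjointness gives `∑ₙ μ(C n) = μ(⋃ₙ C n) ≤ μ(M) < ∞` — contradiction (`no_measurePreserving_chain`, `RobustCounterObstruction_holds`; the printed five-line proof, arXiv p. 29) [cite: CotlerRezchikov2024ComputationalDynamicalSystems, proof of Thm. 4.20].
evasions_known: (i) DISSIPATION: the obstruction needs an invariant finite measure charging every open set; a robustly Turing-universal SMOOTH (non-conservative) self-map of the closed disk exists [cite: CotlerRezchikov2024ComputationalDynamicalSystems, Thm. 1.4 / Thm. 4.4] — so viscosity is not what this entry obstructs (contrast the uniform-perturbation notion of Bournez–Graça–Hainry 2013, under which "adding viscosity … can destroy [the] computational power" of an exactly universal conservative construction [cite: CardonaMirandaPeraltaSalas2025FluidComputer, §4 before OP4]); the dissipative evasion is itself limited by the source's Lemma 4.35 — under TOPOLOGICALLY MIXING dynamics every robust computation halts, so a perpetual counter avoiding some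 open region is impossible with or without an invariant measure (`no_robust_nonhalting_run_of_mixing`, `RobustCounter.false_of_mixing` below) [cite: CotlerRezchikov2024ComputationalDynamicalSystems, Lemma 4.35]; (ii) SHRINKING TOLERANCES: validity regions whose measures are summable (tolerance decreasing along the cascade, as in Tao's averaged-equation construction where the `n`-th stage lives at spatial scale `(1+ε₀)^{-n}`) are not excluded — the entry constrains fixed-tolerance robustness only [cite: Tao2016AveragedNS, §§4–6]; (iii) NON-ROBUST (point) encodings `𝓓⁻¹(s) = {𝓔(s)}` evade trivially and are what CMPP-type theorems use [cite: CotlerRezchikov2024ComputationalDynamicalSystems, §2 'Reasonable state encodings' (p. 8)]; (iv) infinite-dimensional phase space (the PDE itself): outside the theorem's scope, see `scope_caveats` (i).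
scope_caveats: (i) FINITE measure, measure-PRESERVING map: the entry says nothing about the Navier–Stokes or Euler PDE on `𝕋³`/`ℝ³` (infinite-dimensional phase space; for Navier–Stokes no invariant finite measure charging all open sets is available), nothing about blow-up, and nothing about a finite-depth cascade measured with a quantified error budget — the source's abstract restricts to "smooth, finite-dimensional dynamical systems" [cite: CotlerRezchikov2024ComputationalDynamicalSystems, Abstract and Def. 1.1]; (ii) SLOWDOWN: the printed definition lets `τ` vary between connected components of one validity region; the transcription takes one slowdown per region (exactly the printed setting when each `𝓓⁻¹([n]₁)` is connected, and for constant slowdown as in the source's Thms. 1.10, 4.4, 4.15); the printed proof itself treats `f^τ` as a single map [cite: CotlerRezchikov2024ComputationalDynamicalSystems, Def. 1.1 and proof of Thm. 4.20]; (iii) DROPPED printed hypotheses (the entry is the printed statement and more): compactness of `M`, `M ⊂ ℝⁿ`, `supp μ = M`, continuity/smoothness of `f`, and the BSS_C complexity bounds on encoder/decoder (which only restrict which `RobustCounter`s arise from a CDS) — none is used by the printed proof [cite: CotlerRezchikov2024ComputationalDynamicalSystems, proof of Thm. 4.20]; (iv) NOT TRANSCRIBED: Cor. 4.21 (robust Turing-universality;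 needs the CDS/sub-machine formalism of §3), Thm. 1.6 (Axiom A), Thm. 4.15 (generic diffeomorphisms), Thms. 1.10/1.12 (time bounds), and the existence Thm. 1.4; of Thm. 4.24 (continuous time) only the measure-theoretic core is recorded, as `no_measurePreserving_stepChain` / `no_robustCounter_flow` below (finite `μ` assumed outright; the printed `g dV` / invariant-submanifold dressing that localises an infinite measure is not transcribed) [cite: CotlerRezchikov2024ComputationalDynamicalSystems, §§1.2, 4]; (v) SOURCE STATUS: refereed conference proceedings (FOCS 2024), full version arXiv:2409.12179v1; the source's further question whether a `C^∞`-GENERIC `f` can ever be robustly Turing-universal (its item 1.9, §1.2) is left unresolved there and is no part of this entry [cite: CotlerRezchikov2024ComputationalDynamicalSystems, §1.2 item 1.9].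
status: established -/
def RobustCounterObstruction : Prop :=
  ∀ (M : Type) [TopologicalSpace M] [MeasurableSpace M] (μ : Measure M) [IsFiniteMeasure μ]
    [μ.IsOpenPosMeasure] (f : M → M), MeasurePreserving f μ μ → IsEmpty (RobustCounter f)

/-- **Theorem 4.20 holds as stated by the entry** (discharge; the printed proof).
[cite: CotlerRezchikov2024ComputationalDynamicalSystems, Thm. 4.20 (arXiv p. 29)] -/
theorem RobustCounterObstruction_holds : RobustCounterObstruction := by
  intro M _ _ μ _ _ f hf
  refine ⟨fun R => ?_⟩
  have h0 : μ (R.C 0) ≠ 0 := fun h =>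
    (isOpen_interior.measure_ne_zero μ (R.interior_nonempty 0)) (measure_mono_null interior_subset h)
  exact no_measurePreserving_chain hf R.C R.τ R.measurableSet R.disjoint R.mapsTo h0

/-- Universe-polymorphic form of the entry (any `M : Type*`), proved the same way; the catalogue
`Prop` quantifies over `Type` only to remain a single proposition.
[cite: CotlerRezchikov2024ComputationalDynamicalSystems, Thm. 4.20] -/
theorem RobustCounterObstruction.isEmpty {M : Type*} [TopologicalSpace M] [MeasurableSpace M]
    (μ : Measure M) [IsFiniteMeasure μ] [μ.IsOpenPosMeasure] {f : M → M}
    (hf : MeasurePreserving f μ μ) : IsEmpty (RobustCounter f) := by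
  refine ⟨fun R => ?_⟩
  have h0 : μ (R.C 0) ≠ 0 := fun h =>
    (isOpen_interior.measure_ne_zero μ (R.interior_nonempty 0)) (measure_mono_null interior_subset h)
  exact no_measurePreserving_chain hf R.C R.τ R.measurableSet R.disjoint R.mapsTo h0

/-- **Quantitative form used by the machine paradigm (shrinking tolerances).** Under the
hypotheses of the entry, if pairwise-disjoint measurable validity regions `C n` are chained by
iterates of a measure-preserving `f`, then `μ (C 0) = 0`: a robust counter realised for all `n` must
start (hence, by re-indexing, continue) with null validity regions — equivalently, positive fixed
tolerance is impossible and any admissible family of tolerances has summable measures. This is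
the contrapositive of `no_measurePreserving_chain`, recorded for the BARRIERS sections of the
fluid-computer idea cards. [cite: CotlerRezchikov2024ComputationalDynamicalSystems, proof of Thm. 4.20] -/
theorem measure_validityRegion_zero_of_chain {M : Type*} [MeasurableSpace M] {μ : Measure M}
    [IsFiniteMeasure μ] {f : M → M} (hf : MeasurePreserving f μ μ) (C : ℕ → Set M) (τ : ℕ → ℕ)
    (hmeas : ∀ n, MeasurableSet (C n)) (hdisj : Pairwise (Disjoint on C))
    (hmaps : ∀ n, MapsTo f^[τ n] (C n) (C (n + 1))) : μ (C 0) = 0 := by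
  by_contra h0
  exact no_measurePreserving_chain hf C τ hmeas hdisj hmaps h0

/-! ### Continuous time and non-autonomous steps (the measure-theoretic core of Thm. 4.24)

Cotler–Rezchikov's Theorem 4.24 (arXiv p. 29 L32) transfers Theorem 4.20 to continuous-time
systems: "Let `f_t` be a smooth family of diffeomorphisms of a manifold `M`, and suppose that
`f_t^* μ = μ` for a measure `μ` of the form `g dV` where `g : M → M`, `g > 0` … Then `f_t` cannot be
extended to a robust CDS for the machine `Plus`", the slowdown being now a partial function
`τ : M ⇀ ℝ_{≥0}` (their Remark after Def. 4.23: "we can generalize our definition of a CDS to a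
continuous-time dynamical system by letting `τ` be a partial function `τ : M ⇀ ℝ_{≥0}`"). The
pigeonhole does not need the steps to be iterates of one map: it works for ANY sequence of
`μ`-preserving maps `g n` (e.g. `g n = f_{τ n}`, the flow at the `n`-th hand-over time), which is
what the next two declarations record. Their printed extra hypothesis "`M` can be written as a
union of compact invariant submanifolds" serves to localise an infinite `μ` to a finite invariant
piece; here finiteness of `μ` is assumed outright (see the entry's `scope_caveats` (i), (iv)). -/

/-- **Pigeonhole for a chain of (possibly different) measure-preserving steps.** Under a finite
measure `μ`, there is no sequence of pairwise-disjoint measurable sets `C n` with `μ (C 0) ≠ 0`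
such that some `μ`-preserving map `g n` takes `C n` into `C (n+1)` for every `n` — the steps need
not be iterates of a single map (continuous-time flows at arbitrary hand-over times
`g n = f_{τ n}`, or non-autonomous conservative dynamics). Same proof as
`no_measurePreserving_chain`. [cite: CotlerRezchikov2024ComputationalDynamicalSystems, Thm. 4.24 and proof of Thm. 4.20 (arXiv p. 29)] -/
theorem no_measurePreserving_stepChain {M : Type*} [MeasurableSpace M] {μ : Measure M}
    [IsFiniteMeasure μ] (g : ℕ → M → M) (hg : ∀ n, MeasurePreserving (g n) μ μ) (C : ℕ → Set M)
    (hmeas : ∀ n, MeasurableSet (C n)) (hdisj : Pairwise (Disjoint on C))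
    (hmaps : ∀ n, MapsTo (g n) (C n) (C (n + 1))) (h0 : μ (C 0) ≠ 0) : False := by
  have hstep : ∀ n, μ (C n) ≤ μ (C (n + 1)) := by
    intro n
    calc μ (C n) ≤ μ (g n ⁻¹' C (n + 1)) := measure_mono fun x hx => hmaps n hx
      _ = μ (C (n + 1)) := (hg n).measure_preimage (hmeas (n + 1)).nullMeasurableSet
  have hlow : ∀ n, μ (C 0) ≤ μ (C n) := by
    intro n
    induction n with
    | zero => exact le_rfl
    | succ n ih => exact ih.trans (hstep n)
  have hsum : μ (⋃ n, C n) = ∑' n, μ (C n) := measure_iUnion hdisj hmeas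
  have htop : ∑' n, μ (C n) = ∞ := by
    refine top_le_iff.mp ?_
    calc (⊤ : ℝ≥0∞) = ∑' _ : ℕ, μ (C 0) := (ENNReal.tsum_const_eq_top_of_ne_zero h0).symm
      _ ≤ ∑' n, μ (C n) := ENNReal.tsum_le_tsum hlow
  have hfin : μ (⋃ n, C n) < ∞ := measure_lt_top μ _
  rw [hsum, htop] at hfin
  exact lt_irrefl _ hfin

/-- **Continuous-time form (core of Thm. 4.24) for a measure-preserving flow.** If every time-`t`
map `φ t` of a flow (indexed by any type of times `T`, e.g. `ℝ≥0`) preserves a finite measure that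
charges all non-empty open sets, then no choice of hand-over times `τ n : T` and of pairwise-disjoint
measurable validity regions `C n` with non-empty interior satisfies `φ (τ n) '' C n ⊆ C (n+1)` for
all `n`. No semigroup law for `φ` is needed. [cite: CotlerRezchikov2024ComputationalDynamicalSystems, Thm. 4.24 (arXiv p. 29)] -/
theorem no_robustCounter_flow {M : Type*} [TopologicalSpace M] [MeasurableSpace M]
    (μ : Measure M) [IsFiniteMeasure μ] [μ.IsOpenPosMeasure] {T : Type*} (φ : T → M → M)
    (hφ : ∀ t, MeasurePreserving (φ t) μ μ) (τ : ℕ → T) (C : ℕ → Set M)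
    (hmeas : ∀ n, MeasurableSet (C n)) (hint : ∀ n, (interior (C n)).Nonempty)
    (hdisj : Pairwise (Disjoint on C)) (hmaps : ∀ n, MapsTo (φ (τ n)) (C n) (C (n + 1))) :
    False :=
  no_measurePreserving_stepChain (fun n => φ (τ n)) (fun n => hφ (τ n)) C hmeas hdisj hmaps
    (fun h => (isOpen_interior.measure_ne_zero μ (hint 0)) (measure_mono_null interior_subset h))

/-! ### Topologically mixing dynamics: robust computations must halt (Lemma 4.35)

The companion printed statement that does NOT need an invariant measure — so it also speaks to
DISSIPATIVE truncations whose relevant invariant set is mixing (the property the evasion (i) of the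
entry leaves open). Cotler–Rezchikov, **Lemma 4.35** (arXiv p. 32 L14, verbatim): "Let `f` be
topologically mixing. Then any robust CDS with underlying dynamical system `f` must halt on all
inputs." Printed proof (p. 32 L17–L19): "Any configuration `s` … defines a closed set with nonempty
interior, namely `C_s = 𝓓⁻¹(s)`. Similarly, there is a set `𝓗` with nonempty interior which
corresponds to the configurations of `T` in the halting state. Let `C°_s` denote the interior of
`C_s`. Since `f` is topologically mixing, then there is an `N` such that for all `n > N`,
`fⁿ(C°_s) ∩ 𝓗 ≠ ∅`. Suppose that `T` never halts on `s`; then, choosing some `n` large enough we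
must have that `(f^τ)ⁿ(C°_s) ∩ 𝓗 = ∅`, which is a contradiction". Their gloss (p. 34): "if the
halting set overlaps with a part of the subset of the configuration space that is topologically
mixing, any other bit strings which ultimately land in that subset will at some time land in the
halting set." Topological mixing is used in the standard sense the source recalls (p. 19 L33):
"`f` is topologically mixing on `C` if for every two open sets `U` and `V` in `C` … there is an `N`
such that for all `n > N`, `fⁿ(U) ∩ V ≠ ∅`." A perpetual scale counter (Tao's cascade read as the
machine `Plus` run through every `n`) is a non-halting computation, so on a mixing invariant set of a
finite truncation it cannot be robust either — with or without dissipation. -/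

/-- **Topological mixing** of a self-map `f : M → M` (the standard notion, as recalled by the source,
p. 19 L33, with `n ≥ N` for `n > N`, which is the same condition up to the choice of `N`): for all
non-empty open `U, V ⊆ M` there is `N` with `fⁿ(U) ∩ V ≠ ∅` for every `n ≥ N`. [folklore] -/
def IsTopologicallyMixing {M : Type*} [TopologicalSpace M] (f : M → M) : Prop :=
  ∀ U V : Set M, IsOpen U → U.Nonempty → IsOpen V → V.Nonempty →
    ∃ N : ℕ, ∀ n, N ≤ n → ((f^[n] '' U) ∩ V).Nonempty

/-- Cumulative hand-over times `t₀ = 0`, `t_{n+1} = τ n + t_n` of a run with slowdowns `τ n`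
(the exponent of `(f^τ)ⁿ` in the printed proof of Lemma 4.35). [folklore] -/
def handoverTime (τ : ℕ → ℕ) : ℕ → ℕ
  | 0 => 0
  | n + 1 => τ n + handoverTime τ n

/-- Along a run `f^[τ n] : C n → C (n+1)`, the cumulative iterate `f^[t_n]` maps `C 0` into `C n`
(`(f^τ)ⁿ(C_{s₀}) ⊆ C_{s_n}` in the printed proof). [cite: CotlerRezchikov2024ComputationalDynamicalSystems, proof of Lemma 4.35 (arXiv p. 32)] -/
theorem mapsTo_iterate_handoverTime {M : Type*} {f : M → M} (C : ℕ → Set M) (τ : ℕ → ℕ)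
    (hmaps : ∀ n, MapsTo f^[τ n] (C n) (C (n + 1))) :
    ∀ n, MapsTo f^[handoverTime τ n] (C 0) (C n)
  | 0 => fun x hx => by simpa [handoverTime] using hx
  | n + 1 => fun x hx => by
      have hx' : f^[handoverTime τ n] x ∈ C n := mapsTo_iterate_handoverTime C τ hmaps n hx
      show f^[τ n + handoverTime τ n] x ∈ C (n + 1)
      rw [Function.iterate_add_apply]
      exact hmaps n hx'

/-- With every slowdown `τ n ≥ 1` the hand-over times are unbounded: `n ≤ t_n`. [folklore] -/
theorem le_handoverTime (τ : ℕ → ℕ) (hτ : ∀ n, 1 ≤ τ n) : ∀ n, n ≤ handoverTime τ n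
  | 0 => le_rfl
  | n + 1 => by
      have ih := le_handoverTime τ hτ n
      have h1 := hτ n
      show n + 1 ≤ τ n + handoverTime τ n
      omega

/-- **Cotler–Rezchikov 2024, Lemma 4.35 (core): under topologically mixing dynamics a robust
computation cannot run forever outside the halting region.** Let `f : M → M` be topologically
mixing. There is no infinite run `C 0 → C 1 → C 2 → …` of validity regions — `f^[τ n]` mapping `C n`
into `C (n+1)` with slowdowns `τ n ≥ 1`, `C 0` with non-empty interior — all of which avoid a
non-empty OPEN set `H` (printed: the interior of the halting configurations' validity regions,
disjoint from the regions of the non-halting configurations `s_n` visited by a computation that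
"never halts on `s`"). No invariant measure, compactness or conservativity is assumed. In
particular a robust PERPETUAL unary counter (the entry's `RobustCounter`, all of whose regions avoid
some open set) is impossible under mixing, dissipative or not.
[cite: CotlerRezchikov2024ComputationalDynamicalSystems, Lemma 4.35 (arXiv p. 32)] -/
theorem no_robust_nonhalting_run_of_mixing {M : Type*} [TopologicalSpace M] {f : M → M}
    (hf : IsTopologicallyMixing f) (C : ℕ → Set M) (τ : ℕ → ℕ) (hτ : ∀ n, 1 ≤ τ n)
    (h0 : (interior (C 0)).Nonempty) (H : Set M) (hH : IsOpen H) (hHne : H.Nonempty)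
    (havoid : ∀ n, Disjoint (C n) H) (hmaps : ∀ n, MapsTo f^[τ n] (C n) (C (n + 1))) : False := by
  obtain ⟨N, hN⟩ := hf (interior (C 0)) H isOpen_interior h0 hH hHne
  obtain ⟨y, ⟨x, hx, rfl⟩, hyH⟩ := hN (handoverTime τ N) (le_handoverTime τ hτ N)
  have hxC : f^[handoverTime τ N] x ∈ C N :=
    mapsTo_iterate_handoverTime C τ hmaps N (interior_subset hx)
  exact Set.disjoint_left.mp (havoid N) hxC hyH

/-- **Corollary for the entry's object.** Under topologically mixing `f`, a `RobustCounter f` whose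
validity regions all avoid one non-empty open set `H` (any region reserved for a configuration the
counter never visits — e.g. a halting or 'reset' configuration of the ambient machine) and whose
slowdowns are `≥ 1` does not exist. [cite: CotlerRezchikov2024ComputationalDynamicalSystems, Lemma 4.35 (arXiv p. 32)] -/
theorem RobustCounter.false_of_mixing {M : Type*} [TopologicalSpace M] [MeasurableSpace M]
    {f : M → M} (hf : IsTopologicallyMixing f) (R : RobustCounter f) (hτ : ∀ n, 1 ≤ R.τ n)
    (H : Set M) (hH : IsOpen H) (hHne : H.Nonempty) (havoid : ∀ n, Disjoint (R.C n) H) : False :=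
  no_robust_nonhalting_run_of_mixing hf R.C R.τ hτ (R.interior_nonempty 0) H hH hHne havoid R.mapsTo

/-! ### Sharpness of the two hypotheses: a contracting map carries a perpetual robust counter
with SHRINKING validity regions (toy example, not from the source)

The entry obstructs FIXED-tolerance perpetual counters in MEASURE-PRESERVING finite-measure
dynamics. Both hypotheses matter, and the cell's literature files (pub-fluidc LITERATURE §A15.6,
§A16) lean on the printed converse — robust universality EXISTS once validity regions may shrink
non-uniformly (Cotler–Rezchikov Thm. 1.4, "due to the non-uniformity of the allowed amount of
error", arXiv p. 8) or the phase space is unbounded (Bournez–Graça–Hainry 2013, Thms. 19–22). The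
following two-line example records the mechanism in kernel-checked form, for the idea-card
BARRIERS sections; it is folklore, NOT a transcription of either source: the halving map
`x ↦ x/2` of `ℝ` realises the unary counter robustly on the validity regions
`C n = ((1/2)^(n+1), (1/2)^n)` (slowdown `1`), whose Lebesgue measures `(1/2)^(n+1)` shrink
geometrically and sum to `1`; consequently (Theorem 4.20 read backwards) `x ↦ x/2` preserves no
finite Borel measure on `ℝ` charging every non-empty open set. -/

/-- The halving map `x ↦ x/2` of the real line (a contraction; the toy 'dissipative' dynamics of
this section). [folklore] -/
noncomputable abbrev halvingMap : ℝ → ℝ := fun x => x / 2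

/-- Validity region of the configuration `[n]₁` for the halving counter: the open interval
`((1/2)^(n+1), (1/2)^n)`. [folklore] -/
abbrev halvingRegion (n : ℕ) : Set ℝ := Ioo ((1 / 2 : ℝ) ^ (n + 1)) ((1 / 2) ^ n)

/-- One step of the counter: `x ↦ x/2` maps `C n` into `C (n+1)`. [folklore] -/
theorem halvingMap_mapsTo (n : ℕ) : MapsTo halvingMap (halvingRegion n) (halvingRegion (n + 1)) := by
  intro x hx
  simp only [halvingRegion, mem_Ioo, halvingMap] at hx ⊢
  constructor
  · rw [pow_succ]; linarith [hx.1]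
  · rw [pow_succ]; linarith [hx.2]

/-- The validity regions of the halving counter are pairwise disjoint. [folklore] -/
theorem pairwise_disjoint_halvingRegion : Pairwise (Disjoint on halvingRegion) := by
  intro m n hmn
  rcases lt_or_gt_of_ne hmn with h | h
  · refine disjoint_left.2 fun x hxm hxn => ?_
    have hle : (1 / 2 : ℝ) ^ n ≤ (1 / 2) ^ (m + 1) :=
      pow_le_pow_of_le_one (by norm_num) (by norm_num) (Nat.succ_le_of_lt h)
    exact absurd (hxn.2.trans_le hle) (not_lt.2 hxm.1.le)
  · refine disjoint_left.2 fun x hxm hxn => ?_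
    have hle : (1 / 2 : ℝ) ^ m ≤ (1 / 2) ^ (n + 1) :=
      pow_le_pow_of_le_one (by norm_num) (by norm_num) (Nat.succ_le_of_lt h)
    exact absurd (hxm.2.trans_le hle) (not_lt.2 hxn.1.le)

/-- **A perpetual robust counter for a non-measure-preserving map.** The halving map `x ↦ x/2`
of `ℝ` carries a `RobustCounter` (validity regions `halvingRegion n`, slowdown `1`): the
conclusion of Theorem 4.20 fails without measure preservation, and it fails with validity regions
whose sizes shrink along the run — the regime of the printed existence results
(Cotler–Rezchikov Thm. 1.4; Bournez–Graça–Hainry 2013 Thms. 19–22). Toy example, not from the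
source. [folklore] -/
noncomputable def halvingCounter : RobustCounter halvingMap where
  C := halvingRegion
  τ := fun _ => 1
  measurableSet := fun _ => measurableSet_Ioo
  interior_nonempty := fun n => by
    rw [interior_Ioo]
    exact nonempty_Ioo.2 (pow_lt_pow_right_of_lt_one₀ (by norm_num) (by norm_num) n.lt_succ_self)
  disjoint := pairwise_disjoint_halvingRegion
  mapsTo := fun n => by
    rw [Function.iterate_one]
    exact halvingMap_mapsTo n

/-- The type of robust counters for the halving map is inhabited. [folklore] -/
theorem nonempty_robustCounter_halvingMap : Nonempty (RobustCounter halvingMap) :=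
  ⟨halvingCounter⟩

/-- **Shrinking tolerances, quantitatively:** the `n`-th validity region of the halving counter
has Lebesgue measure `(1/2)^(n+1)`. [folklore] -/
theorem volume_halvingRegion (n : ℕ) :
    volume (halvingRegion n) = ENNReal.ofReal ((1 / 2 : ℝ) ^ (n + 1)) := by
  rw [halvingRegion, Real.volume_Ioo]
  congr 1
  rw [pow_succ]; ring

/-- … and these measures are summable, with total `1` (contrast
`measure_validityRegion_zero_of_chain`: under a finite INVARIANT measure the regions of a chain are
null). [folklore] -/
theorem tsum_volume_halvingRegion : ∑' n, volume (halvingRegion n) = 1 := by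
  have hfun : (fun n : ℕ => (1 / 2 : ℝ) ^ (n + 1)) = fun n : ℕ => 1 / 2 * (1 / 2) ^ n := by
    funext n
    rw [pow_succ']
  have hgeom : HasSum (fun n : ℕ => (1 / 2 : ℝ) ^ (n + 1)) 1 := by
    have h : HasSum (fun n : ℕ => 1 / 2 * (1 / 2 : ℝ) ^ n) (1 / 2 * 2) :=
      hasSum_geometric_two.mul_left (1 / 2 : ℝ)
    rw [show (1 / 2 * 2 : ℝ) = 1 by norm_num] at h
    rw [hfun]
    exact h
  simp_rw [volume_halvingRegion]
  rw [← ENNReal.ofReal_tsum_of_nonneg (fun n => by positivity) hgeom.summable, hgeom.tsum_eq,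
    ENNReal.ofReal_one]

/-- **Theorem 4.20 read backwards on the toy:** the halving map preserves no finite Borel measure
on `ℝ` that charges every non-empty open set (else `halvingCounter` would contradict the entry).
[cite: CotlerRezchikov2024ComputationalDynamicalSystems, Thm. 4.20 (arXiv p. 29)] -/
theorem not_measurePreserving_halvingMap (μ : Measure ℝ) [IsFiniteMeasure μ] [μ.IsOpenPosMeasure] :
    ¬ MeasurePreserving halvingMap μ μ := fun h =>
  (RobustCounterObstruction.isEmpty μ h).false halvingCounter

/-! ### Sharpness, continued: UNIFORM tolerance, and an UNBOUNDED conservative phase space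
(toy statements, not from the source)

Two more elementary facts complete the dichotomy used by the cell's literature files
(pub-fluidc LITERATURE §A15.6): (1) with a UNIFORM lower bound on the measure of the validity
regions ("fixed tolerance"), a perpetual counter is impossible in ANY finite-measure phase space,
measure preservation or not — the pigeonhole behind the 'bounded memory' reading of uniformly
perturbed compact systems (Bournez–Graça–Hainry 2013, Thm. 13's finite grid automaton;
Braverman–Rojas–Schneider 2015, 'finite memory'); (2) in an INFINITE-measure phase space a
measure-PRESERVING map can carry a perpetual robust counter with uniform tolerance: the unit
translation `x ↦ x + 1` of `ℝ` on the regions `(n, n+1)`, each of Lebesgue measure `1` — the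
regime of the printed existence results on unbounded domains (Bournez–Graça–Hainry 2013,
Thms. 19–21: "infinitely many robustly distinguishable states"). Both are folklore and labelled so;
neither is a transcription of a printed theorem. -/

/-- **Uniform tolerance ⇒ no perpetual counter in finite measure (pigeonhole).** Pairwise-disjoint
measurable sets `C n` whose measures are bounded below by a fixed `ε ≠ 0` cannot exist under a
finite measure — whatever the dynamics. [folklore] -/
theorem no_chain_of_uniform_measure {M : Type*} [MeasurableSpace M] (μ : Measure M)
    [IsFiniteMeasure μ] (C : ℕ → Set M) (hmeas : ∀ n, MeasurableSet (C n))
    (hdisj : Pairwise (Disjoint on C)) {ε : ℝ≥0∞} (hε : ε ≠ 0) (hbig : ∀ n, ε ≤ μ (C n)) :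
    False := by
  have hsum : μ (⋃ n, C n) = ∑' n, μ (C n) := measure_iUnion hdisj hmeas
  have htop : ∑' n, μ (C n) = ∞ := by
    refine top_le_iff.mp ?_
    calc (⊤ : ℝ≥0∞) = ∑' _ : ℕ, ε := (ENNReal.tsum_const_eq_top_of_ne_zero hε).symm
      _ ≤ ∑' n, μ (C n) := ENNReal.tsum_le_tsum hbig
  have hfin : μ (⋃ n, C n) < ∞ := measure_lt_top μ _
  rw [hsum, htop] at hfin
  exact lt_irrefl _ hfin

/-- **Corollary for the entry's object:** under ANY finite measure `μ` (invariant or not), a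
`RobustCounter f` whose validity regions all have `μ`-measure `≥ ε` for a fixed `ε ≠ 0` does not
exist. [folklore] -/
theorem RobustCounter.false_of_uniform_measure {M : Type*} [TopologicalSpace M]
    [MeasurableSpace M] {f : M → M} (R : RobustCounter f) (μ : Measure M) [IsFiniteMeasure μ]
    {ε : ℝ≥0∞} (hε : ε ≠ 0) (hbig : ∀ n, ε ≤ μ (R.C n)) : False :=
  no_chain_of_uniform_measure μ R.C R.measurableSet R.disjoint hε hbig

/-- The unit translation `x ↦ x + 1` of the real line (measure-preserving for Lebesgue measure,
which is infinite). [folklore] -/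
noncomputable abbrev translationMap : ℝ → ℝ := fun x => x + 1

/-- Validity region of `[n]₁` for the translation counter: the open interval `(n, n+1)`.
[folklore] -/
abbrev translationRegion (n : ℕ) : Set ℝ := Ioo (n : ℝ) (n + 1)

/-- One step of the translation counter: `x ↦ x + 1` maps `(n, n+1)` into `(n+1, n+2)`. [folklore] -/
theorem translationMap_mapsTo (n : ℕ) :
    MapsTo translationMap (translationRegion n) (translationRegion (n + 1)) := by
  intro x hx
  simp only [translationRegion, mem_Ioo, Nat.cast_add, Nat.cast_one, translationMap] at hx ⊢
  constructor <;> linarith [hx.1, hx.2]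

/-- The regions `(n, n+1)` are pairwise disjoint. [folklore] -/
theorem pairwise_disjoint_translationRegion : Pairwise (Disjoint on translationRegion) := by
  intro m n hmn
  rcases lt_or_gt_of_ne hmn with h | h
  · refine disjoint_left.2 fun x hxm hxn => ?_
    have : (m : ℝ) + 1 ≤ n := by exact_mod_cast Nat.succ_le_of_lt h
    simp only [translationRegion, mem_Ioo] at hxm hxn
    linarith
  · refine disjoint_left.2 fun x hxm hxn => ?_
    have : (n : ℝ) + 1 ≤ m := by exact_mod_cast Nat.succ_le_of_lt h
    simp only [translationRegion, mem_Ioo] at hxm hxn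
    linarith

/-- **A perpetual robust counter with UNIFORM tolerance for a MEASURE-PRESERVING map of an
infinite-measure space.** The unit translation of `ℝ` carries a `RobustCounter` on the regions
`(n, n+1)` (slowdown `1`): the finiteness hypothesis of Theorem 4.20 cannot be dropped, and with
unboundedly many fixed-size validity regions a conservative dynamics counts forever (cf.
Bournez–Graça–Hainry 2013, Thms. 19–21). Toy example, not from the source. [folklore] -/
noncomputable def translationCounter : RobustCounter translationMap where
  C := translationRegion
  τ := fun _ => 1
  measurableSet := fun _ => measurableSet_Ioo
  interior_nonempty := fun n => by
    rw [interior_Ioo]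
    exact nonempty_Ioo.2 (by linarith)
  disjoint := pairwise_disjoint_translationRegion
  mapsTo := fun n => by
    rw [Function.iterate_one]
    exact translationMap_mapsTo n

/-- Every validity region of the translation counter has Lebesgue measure `1` (uniform
tolerance). [folklore] -/
theorem volume_translationRegion (n : ℕ) : volume (translationRegion n) = 1 := by
  rw [translationRegion, Real.volume_Ioo]
  simp

/-- The unit translation preserves Lebesgue measure. [folklore] -/
theorem measurePreserving_translationMap : MeasurePreserving translationMap volume volume :=
  measurePreserving_add_right volume 1

/-- **Theorem 4.20 read backwards on the second toy:** Lebesgue measure on `ℝ` being invariant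
under `translationMap` and charging open sets, it cannot be finite — recovered here from the entry
(of course also immediate directly). [cite: CotlerRezchikov2024ComputationalDynamicalSystems, Thm. 4.20 (arXiv p. 29)] -/
theorem not_isFiniteMeasure_volume_real : ¬ IsFiniteMeasure (volume : Measure ℝ) := fun _ =>
  (RobustCounterObstruction.isEmpty (volume : Measure ℝ) measurePreserving_translationMap).false
    translationCounter


end Literature.Barriers.NavierStokesRegularity
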